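import Summits.ResolutionOfSingularities.ResolutionOfSingularities.Theorems.EquisingularLiftEquisingularLiftNatRegularSequenceAway
import Summits.ResolutionOfSingularities.ResolutionOfSingularities.Theorems.EquisingularLiftEquisingularLiftNatIdealSheafSpread
import Literature.AlgebraicGeometry.Resolution.CanonicalResolutionSmoothCentre
import Literature.AlgebraicGeometry.Resolution.AlterationsSectionDivisor
import Mathlib.RingTheory.RegularLocalRing.Defs
import HarnessLib

/-!
# [OURS · L1 W4.5(b) · EL♮(3)] (T-k) brick P2 — a closed immersion of a regular scheme into a scheme regular along it is cut out,
# near every point, by a weakly regular sequence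

Crux chain w45b (cell `res-hironaka`, slot W4.5(b)), child crux **EL♮(3)** = stmt-ResolutionOfSingularities-20148, route EquisingularLift;
hypothesis-residue (T-k) `EmbeddedCurveLiftFact`, res-type-027 g16's census (`L/res-type-027/EMBEDDED-CURVE-LIFT-CENSUS.md` 23253b6cd880a2d6),
brick **P2** = desk object (O1), signature `L/res-type-027/EmbeddedCurveLift-Tk.sig.lean` b8b6b462233a4b0c l.86–92 VERBATIM. Written by
res-D-pv-035 g9. HONEST FRAMING: OURS; NOT a statement of any manuscript; AI-written, weaker than expert review. No `sorry`; standard axioms;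
DEF-FREE. `--supports stmt-ResolutionOfSingularities-20148 --as helper`.

PROOF of `locallyRegularSequence_of_isRegular` (assembly of tree facts, by name): at `z`,
(1) `ker (𝒪_{E,i z} ↠ 𝒪_{Z,z})` (`Scheme.Hom.stalkMap_surjective`) has regular quotient (`IsRegularLocalRing.of_ringEquiv`), hence is
    generated by a sub-family `u ∘ ι` of a minimal basis `u` of `𝔪` (`exists_rsop_of_isRegularLocalRing_quotient`), a part of a regular system
    of parameters (`isRsopPart_comp_of_rsop`);
(2) the germs `u ∘ ι` are germs of sections `s` on a basic open of an affine neighbourhood (`exists_basicOpen_sections_of_germs`);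
(3) `(i.ker)_{i z} = ker (stalk map)` (`stalkIdeal_ker_eq_ker_stalkMap`), so the `s` generate `i.ker` on a smaller basic open
    (`exists_basicOpen_ideal_eq_map`);
(4) on a still smaller basic open the restricted sections form a weakly regular sequence (`exists_basicOpen_isWeaklyRegular_of_isRsopPart_germ`,
    p596109), and they still generate (`IdealSheafData.map_ideal`).
-/

set_option linter.dupNamespace false -- mandated namespace `Summit.<Summit>.<Problem>` of this single-conjunct summit

noncomputable section

open CategoryTheory AlgebraicGeometry TopologicalSpace Opposite IsLocalRing
open Literature.AlgebraicGeometry.Resolution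

namespace Summit.ResolutionOfSingularities.ResolutionOfSingularities.Cruxes.EquisingularLiftNat.Sections

universe u

/-- `Ideal.ofList (List.ofFn f)` is the span of the range of `f`. [folklore] -/
theorem ofList_ofFn_eq_span_range {R : Type u} [CommSemiring R] {n : ℕ} (f : Fin n → R) :
    Ideal.ofList (List.ofFn f) = Ideal.span (Set.range f) := by
  rw [Ideal.ofList]
  congr 1
  ext r
  simp [List.mem_ofFn']

/-- Restricting sections commutes with taking the span of their range: `(span (range s))·Γ(V) = span (range (s|_V))`. [folklore] -/
theorem map_span_range_eq {X : Scheme.{u}} {U V : X.Opens} (h : V ≤ U) {n : ℕ} (s : Fin n → Γ(X, U)) :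
    (Ideal.span (Set.range s)).map (X.presheaf.map (homOfLE h).op).hom =
      Ideal.span (Set.range fun j => (X.presheaf.map (homOfLE h).op).hom (s j)) := by
  rw [Ideal.map_span, ← Set.range_comp]
  rfl

/-- **P2 — local complete intersection from regular-in-regular.** A closed immersion `i : Z ⟶ E` of schemes, `E` locally Noetherian,
with `Z` regular and `E` regular along `Z`, is cut out near every point of `Z` by a weakly regular sequence of sections generating the
ideal sheaf of `i` there. See the module docstring for the assembly. [OURS · L1 W4.5b · (T-k) P2 (res-type-027 sig b8b6b462233a4b0c, verbatim);
method: Matsumura1987 Thms. 14.2, 16.1, index only] -/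
theorem locallyRegularSequence_of_isRegular {Z E : Scheme.{0}} [IsLocallyNoetherian E] (i : Z ⟶ E) [IsClosedImmersion i]
    (hZ : ∀ x : Z, IsRegularLocalRing (Z.presheaf.stalk x)) (hE : ∀ x : Z, IsRegularLocalRing (E.presheaf.stalk (i x))) :
    ∀ z : Z, ∃ U : E.affineOpens, i.base z ∈ (U : E.Opens) ∧
      ∃ rs : List Γ(E, U), RingTheory.Sequence.IsWeaklyRegular Γ(E, U) rs ∧ Ideal.ofList rs = i.ker.ideal U := by
  classical
  intro z
  -- (1) the kernel of the stalk map is generated by part of a regular system of parameters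
  haveI hR : IsRegularLocalRing (E.presheaf.stalk (i.base z)) := hE z
  haveI hRz : IsRegularLocalRing (Z.presheaf.stalk z) := hZ z
  set J : Ideal (E.presheaf.stalk (i.base z)) := RingHom.ker (i.stalkMap z).hom with hJ
  have hsurj : Function.Surjective (i.stalkMap z).hom := i.stalkMap_surjective z
  haveI : IsRegularLocalRing (E.presheaf.stalk (i.base z) ⧸ J) :=
    IsRegularLocalRing.of_ringEquiv (RingHom.quotientKerEquivOfSurjective hsurj).symm
  have hJm : J ≤ maximalIdeal _ := IsLocalRing.le_maximalIdeal (RingHom.ker_ne_top _)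
  obtain ⟨u, hu, S, hJS⟩ := exists_rsop_of_isRegularLocalRing_quotient hJm
  obtain ⟨n, ι, hιinj, hιS⟩ : ∃ (n : ℕ) (ι : Fin n → Fin (maximalIdeal (E.presheaf.stalk (i.base z))).spanFinrank),
      Function.Injective ι ∧ Set.range ι = S := by
    haveI : Fintype S := Fintype.ofFinite _
    refine ⟨Fintype.card S, Subtype.val ∘ (Fintype.equivFin S).symm,
      Subtype.val_injective.comp (Fintype.equivFin S).symm.injective, ?_⟩
    rw [Set.range_comp, Equiv.range_eq_univ, Set.image_univ, Subtype.range_coe]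
  have hpart : IsRsopPart (u ∘ ι) := isRsopPart_comp_of_rsop rfl u hu ι hιinj
  have hJspan : Ideal.span (Set.range (u ∘ ι)) = J := by
    rw [Set.range_comp, hιS, hJS]
  -- (2) sections realising the germs, on a basic open `D(r₁)` of an affine neighbourhood `U₀`
  obtain ⟨U₀, hU₀, hzU₀, -⟩ :=
    exists_isAffineOpen_mem_and_subset (X := E) (x := i.base z) (U := ⊤) (Opens.mem_top _)
  obtain ⟨r₁, hzr₁, s, hs⟩ := exists_basicOpen_sections_of_germs (⟨U₀, hU₀⟩ : E.affineOpens) hzU₀ (u ∘ ι)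
  -- (3) the sections generate `i.ker` on a smaller basic open `D(r₂)`
  have hK : stalkIdeal i.ker (i.base z) =
      (Ideal.span (Set.range s)).map (E.presheaf.germ (E.affineBasicOpen r₁) (i.base z) hzr₁).hom := by
    rw [Ideal.map_span, ← Set.range_comp]
    have hfun : ((E.presheaf.germ (E.affineBasicOpen r₁) (i.base z) hzr₁).hom ∘ s) = u ∘ ι := funext hs
    rw [hfun, hJspan, hJ]
    exact stalkIdeal_ker_eq_ker_stalkMap i z
  obtain ⟨r₂, hzr₂, hgen⟩ := exists_basicOpen_ideal_eq_map i.ker (E.affineBasicOpen r₁) hzr₁ (Ideal.span (Set.range s)) hK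
  set s₂ : Fin n → Γ(E, E.affineBasicOpen r₂) := fun j => (E.presheaf.map (homOfLE (E.basicOpen_le r₂)).op).hom (s j)
    with hs₂
  have hgen₂ : i.ker.ideal (E.affineBasicOpen r₂) = Ideal.span (Set.range s₂) :=
    hgen.trans (map_span_range_eq (E.basicOpen_le r₂) s)
  -- (4) weak regularity on a basic open `D(g)` of `D(r₂)`
  have hgerm₂ : IsRsopPart (fun j => (E.presheaf.germ (E.affineBasicOpen r₂) (i.base z) hzr₂).hom (s₂ j)) := by
    have hfun : (fun j => (E.presheaf.germ (E.affineBasicOpen r₂) (i.base z) hzr₂).hom (s₂ j)) = u ∘ ι := by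
      funext j
      rw [← hs j, hs₂]
      exact TopCat.Presheaf.germ_res_apply E.presheaf (homOfLE (E.basicOpen_le r₂)) (i.base z) hzr₂ (s j)
    rw [hfun]
    exact hpart
  obtain ⟨g, hzg, hreg⟩ :=
    exists_basicOpen_isWeaklyRegular_of_isRsopPart_germ (E.affineBasicOpen r₂) hzr₂ s₂ hgerm₂
  refine ⟨E.affineBasicOpen g, hzg, List.ofFn fun j => (E.presheaf.map (homOfLE (E.basicOpen_le g)).op).hom (s₂ j), hreg, ?_⟩
  -- the restricted sections still generate
  rw [ofList_ofFn_eq_span_range]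
  have hmap := i.ker.map_ideal (U := E.affineBasicOpen g) (V := E.affineBasicOpen r₂) (E.basicOpen_le g)
  exact ((hmap.symm.trans (congrArg (fun K => Ideal.map (E.presheaf.map (homOfLE (E.basicOpen_le g)).op).hom K) hgen₂)).trans
    (map_span_range_eq (E.basicOpen_le g) s₂)).symm

end Summit.ResolutionOfSingularities.ResolutionOfSingularities.Cruxes.EquisingularLiftNat.Sections

end
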